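import Mathlib
import HarnessLib

/-!
# `DensityLadder.SeparatedTowerDensityLine` (item stmt-RiemannHypothesis-24918) — decay of the
# window transform (step (c2) of stub S1: two integrations by parts)

LINE L57 «sieve sight above the density line» (rh-idea-10 g1), crux K1 `SeparatedTowerDensityLine`,
stub S1 of the registered skeleton `Birth.lean`, step (c2) of the mean-value argument (seat memo
`MEANVALUE-SECOND-READ.md` on stmt-RiemannHypothesis-24918): for a `C²` bump `φ` vanishing off
`(−1, 1)`, `0 < η ≤ 1/2` and `ρ ≠ 0, −1`,
`∫_{-1}^{1} φ(v)(1+ηv)^{ρ−1} dv = (η²ρ(ρ+1))^{-1} ∫_{-1}^{1} φ''(v)(1+ηv)^{ρ+1} dv`, whence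
`‖ĉ_ρ(η)‖ ≤ (9/2) sup|φ''| / (η² |ρ| |ρ+1|)` for `Re ρ ≤ 1` — the decay `≪ (η|γ|)^{-2}` that makes the
zero side of the window formula locally summable and the tame/tower tails small above height
`T = 1/η`.
Cell rh-split, seat rh-split-prover-l57 g0.  RH-free, ζ-free; FRONTIER bookkeeping; nothing here
bears on the truth of RH.
-/

set_option linter.dupNamespace false

noncomputable section

open Complex Filter Set MeasureTheory Topology
open scoped Real

namespace Summit.RiemannHypothesis.RiemannHypothesis.Theorems.DensityLadderSeparatedTowerTransformDecay

/-- Derivative of the window power in the real variable: for `1 + ηv > 0`,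
`d/dv (1+ηv)^c = c (1+ηv)^{c−1} η`. [folklore] -/
theorem hasDerivAt_base_cpow {η v : ℝ} (hpos : 0 < 1 + η * v) (c : ℂ) :
    HasDerivAt (fun v : ℝ ↦ ((1 : ℂ) + (η : ℂ) * (v : ℂ)) ^ c)
      (c * ((1 : ℂ) + (η : ℂ) * (v : ℂ)) ^ (c - 1) * η) v := by
  have h1 : HasDerivAt (fun z : ℂ ↦ (1 : ℂ) + (η : ℂ) * z) ((η : ℂ) * 1) (v : ℂ) :=
    ((hasDerivAt_id (v : ℂ)).const_mul (η : ℂ)).const_add 1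
  have hslit : (1 : ℂ) + (η : ℂ) * (v : ℂ) ∈ slitPlane := by
    rw [Complex.mem_slitPlane_iff]; left
    simp only [add_re, one_re, mul_re, ofReal_re, ofReal_im, mul_zero, sub_zero]; exact hpos
  have h2 := h1.cpow_const (c := c) hslit
  rw [mul_one] at h2
  exact h2.comp_ofReal

/-- The window power is continuous on `[−1, 1]` in the real variable (`0 < η ≤ 1/2`). [folklore] -/
theorem continuousOn_base_cpow {η : ℝ} (hη : 0 < η) (hη1 : η ≤ 1 / 2) (c : ℂ) :
    ContinuousOn (fun v : ℝ ↦ ((1 : ℂ) + (η : ℂ) * (v : ℂ)) ^ c) (uIcc (-1 : ℝ) 1) := by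
  intro v hv
  rw [uIcc_of_le (by norm_num), mem_Icc] at hv
  have hpos : 0 < 1 + η * v := by nlinarith
  exact (hasDerivAt_base_cpow hpos c).continuousAt.continuousWithinAt

/-- A `C¹` function vanishing for `|v| ≥ 1` has vanishing derivative at `±1`. [folklore] -/
theorem deriv_eq_zero_of_vanish {φ : ℝ → ℝ} (hφ : Differentiable ℝ φ) (hφs : ∀ v, 1 ≤ |v| → φ v = 0) :
    deriv φ 1 = 0 ∧ deriv φ (-1) = 0 := by
  constructor
  · rw [← (hφ 1).derivWithin (uniqueDiffWithinAt_Ici 1)]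
    have hEq : EqOn φ (fun _ ↦ (0 : ℝ)) (Ici (1 : ℝ)) := fun v hv ↦
      hφs v (le_trans (mem_Ici.1 hv) (le_abs_self v))
    rw [derivWithin_congr hEq (hφs 1 (by norm_num))]
    simp
  · rw [← (hφ (-1)).derivWithin (uniqueDiffWithinAt_Iic (-1))]
    have hEq : EqOn φ (fun _ ↦ (0 : ℝ)) (Iic (-1 : ℝ)) := fun v hv ↦
      hφs v (by rw [mem_Iic] at hv; rw [abs_of_nonpos (by linarith)]; linarith)
    rw [derivWithin_congr hEq (hφs (-1) (by norm_num))]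
    simp

/-- **One integration by parts on the window**: for `ψ ∈ C¹` with `ψ(±1) = 0`, `0 < η ≤ 1/2` and
`c ≠ 0`, `∫_{-1}^{1} ψ(v)(1+ηv)^{c−1} dv = −(ηc)^{-1} ∫_{-1}^{1} ψ'(v)(1+ηv)^{c} dv`. [folklore] -/
theorem window_ibp (ψ : ℝ → ℝ) (hψ : ContDiff ℝ 1 ψ) (hψ1 : ψ 1 = 0) (hψm1 : ψ (-1) = 0)
    {η : ℝ} (hη : 0 < η) (hη1 : η ≤ 1 / 2) {c : ℂ} (hc : c ≠ 0) :
    ∫ v in (-1 : ℝ)..1, (ψ v : ℂ) * ((1 : ℂ) + (η : ℂ) * (v : ℂ)) ^ (c - 1) =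
      -(1 / ((η : ℂ) * c)) * ∫ v in (-1 : ℝ)..1, ((deriv ψ v : ℝ) : ℂ) * ((1 : ℂ) + (η : ℂ) * (v : ℂ)) ^ c := by
  have hηc : (η : ℂ) * c ≠ 0 := mul_ne_zero (by exact_mod_cast hη.ne') hc
  -- `V(v) = (1+ηv)^c / (ηc)` has derivative `(1+ηv)^{c-1}`
  set V : ℝ → ℂ := fun v ↦ ((1 : ℂ) + (η : ℂ) * (v : ℂ)) ^ c / ((η : ℂ) * c) with hV
  have hVd : ∀ v ∈ uIcc (-1 : ℝ) 1, HasDerivAt V (((1 : ℂ) + (η : ℂ) * (v : ℂ)) ^ (c - 1)) v := by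
    intro v hv
    rw [uIcc_of_le (by norm_num), mem_Icc] at hv
    have hpos : 0 < 1 + η * v := by nlinarith
    have h := (hasDerivAt_base_cpow hpos c).div_const ((η : ℂ) * c)
    refine h.congr_deriv ?_
    rw [div_eq_iff hηc]
    ring
  have hud : ∀ v ∈ uIcc (-1 : ℝ) 1, HasDerivAt (fun v ↦ (ψ v : ℂ)) (((deriv ψ v : ℝ) : ℂ)) v :=
    fun v _ ↦ ((hψ.differentiable one_ne_zero v).hasDerivAt).ofReal_comp
  have hu' : IntervalIntegrable (fun v ↦ ((deriv ψ v : ℝ) : ℂ)) volume (-1 : ℝ) 1 :=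
    (Complex.continuous_ofReal.comp (hψ.continuous_deriv le_rfl)).intervalIntegrable _ _
  have hv' : IntervalIntegrable (fun v : ℝ ↦ ((1 : ℂ) + (η : ℂ) * (v : ℂ)) ^ (c - 1)) volume (-1 : ℝ) 1 :=
    (continuousOn_base_cpow hη hη1 (c - 1)).intervalIntegrable
  have key := intervalIntegral.integral_mul_deriv_eq_deriv_mul hud hVd hu' hv'
  rw [key, hψ1, hψm1]
  simp only [Complex.ofReal_zero, zero_mul, sub_zero]
  rw [zero_sub, ← intervalIntegral.integral_neg, ← intervalIntegral.integral_const_mul]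
  refine intervalIntegral.integral_congr fun v _ ↦ ?_
  simp only [hV]
  field_simp

/-- **Two integrations by parts**: for `φ ∈ C²` vanishing for `|v| ≥ 1`, `0 < η ≤ 1/2`,
`ρ ≠ 0`, `ρ ≠ −1`:
`∫_{-1}^{1} φ(v)(1+ηv)^{ρ−1} dv = (η²ρ(ρ+1))^{-1} ∫_{-1}^{1} φ''(v)(1+ηv)^{ρ+1} dv`. [folklore] -/
theorem windowTransform_eq_second_deriv (φ : ℝ → ℝ) (hφ : ContDiff ℝ 2 φ)
    (hφs : ∀ v, 1 ≤ |v| → φ v = 0) {η : ℝ} (hη : 0 < η) (hη1 : η ≤ 1 / 2) {ρ : ℂ}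
    (hρ0 : ρ ≠ 0) (hρ1 : ρ + 1 ≠ 0) :
    ∫ v in (-1 : ℝ)..1, (φ v : ℂ) * ((1 : ℂ) + (η : ℂ) * (v : ℂ)) ^ (ρ - 1) =
      (1 / ((η : ℂ) ^ 2 * ρ * (ρ + 1))) *
        ∫ v in (-1 : ℝ)..1, ((deriv (deriv φ) v : ℝ) : ℂ) * ((1 : ℂ) + (η : ℂ) * (v : ℂ)) ^ (ρ + 1) := by
  have hφ1c : ContDiff ℝ 1 φ := hφ.of_le (by norm_num)
  have hdφ : ContDiff ℝ 1 (deriv φ) := hφ.deriv'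
  obtain ⟨hd1, hdm1⟩ := deriv_eq_zero_of_vanish (hφ1c.differentiable one_ne_zero) hφs
  have step1 := window_ibp φ hφ1c (hφs 1 (by norm_num)) (hφs (-1) (by norm_num)) hη hη1 hρ0
  have step2 := window_ibp (deriv φ) hdφ hd1 hdm1 hη hη1 hρ1
  rw [add_sub_cancel_right] at step2
  rw [step1, step2]
  have hη0 : (η : ℂ) ≠ 0 := by exact_mod_cast hη.ne'
  rw [← mul_assoc]
  congr 1
  field_simp

/-- **Decay of the window transform**: for `φ ∈ C²` vanishing for `|v| ≥ 1` with `|φ''| ≤ M₂`,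
`0 < η ≤ 1/2`, `0 ≤ Re ρ ≤ 1`, `ρ ≠ 0, −1`:
`‖∫_{-1}^{1} φ(v)(1+ηv)^{ρ−1} dv‖ ≤ (9/2) M₂ / (η² ‖ρ‖ ‖ρ+1‖)`. [folklore] -/
theorem norm_windowTransform_le_decay (φ : ℝ → ℝ) (hφ : ContDiff ℝ 2 φ)
    (hφs : ∀ v, 1 ≤ |v| → φ v = 0) {M₂ : ℝ} (hM2 : ∀ v, |deriv (deriv φ) v| ≤ M₂)
    {η : ℝ} (hη : 0 < η) (hη1 : η ≤ 1 / 2) {ρ : ℂ} (h0 : 0 ≤ ρ.re) (h1 : ρ.re ≤ 1)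
    (hρ0 : ρ ≠ 0) (hρ1 : ρ + 1 ≠ 0) :
    ‖∫ v in (-1 : ℝ)..1, (φ v : ℂ) * ((1 : ℂ) + (η : ℂ) * (v : ℂ)) ^ (ρ - 1)‖ ≤
      9 / 2 * M₂ / (η ^ 2 * ‖ρ‖ * ‖ρ + 1‖) := by
  have hM0 : 0 ≤ M₂ := (abs_nonneg _).trans (hM2 0)
  rw [windowTransform_eq_second_deriv φ hφ hφs hη hη1 hρ0 hρ1, norm_mul]
  have hI : ‖∫ v in (-1 : ℝ)..1, ((deriv (deriv φ) v : ℝ) : ℂ) * ((1 : ℂ) + (η : ℂ) * (v : ℂ)) ^ (ρ + 1)‖ ≤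
      M₂ * (9 / 4) * |1 - (-1 : ℝ)| := by
    refine intervalIntegral.norm_integral_le_of_norm_le_const fun v hv ↦ ?_
    rw [uIoc_of_le (by norm_num), mem_Ioc] at hv
    have hpos : 0 < 1 + η * v := by nlinarith
    have hle : 1 + η * v ≤ 3 / 2 := by nlinarith
    have hb : ((1 : ℂ) + (η : ℂ) * (v : ℂ)) = ((1 + η * v : ℝ) : ℂ) := by push_cast; ring
    rw [norm_mul, Complex.norm_real, Real.norm_eq_abs, hb, Complex.norm_cpow_eq_rpow_re_of_pos hpos]
    have hre : (ρ + 1).re = ρ.re + 1 := by simp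
    rw [hre]
    have hpow : (1 + η * v) ^ (ρ.re + 1) ≤ 9 / 4 :=
      calc (1 + η * v) ^ (ρ.re + 1) ≤ (3 / 2 : ℝ) ^ (ρ.re + 1) :=
            Real.rpow_le_rpow hpos.le hle (by linarith)
        _ ≤ (3 / 2 : ℝ) ^ (2 : ℝ) := Real.rpow_le_rpow_of_exponent_le (by norm_num) (by linarith)
        _ = 9 / 4 := by norm_num
    exact mul_le_mul (hM2 v) hpow (Real.rpow_nonneg hpos.le _) hM0
  have hnorm : ‖(1 / ((η : ℂ) ^ 2 * ρ * (ρ + 1)))‖ = 1 / (η ^ 2 * ‖ρ‖ * ‖ρ + 1‖) := by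
    rw [norm_div, norm_one, norm_mul, norm_mul, norm_pow, Complex.norm_real, Real.norm_eq_abs,
      abs_of_pos hη]
  rw [hnorm]
  have hden : 0 < η ^ 2 * ‖ρ‖ * ‖ρ + 1‖ := by
    have := norm_pos_iff.2 hρ0; have := norm_pos_iff.2 hρ1; positivity
  rw [show |(1 : ℝ) - (-1)| = 2 by norm_num] at hI
  rw [div_mul_eq_mul_div, one_mul, div_le_div_iff_of_pos_right hden]
  linarith

end Summit.RiemannHypothesis.RiemannHypothesis.Theorems.DensityLadderSeparatedTowerTransformDecay

end
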